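import Summits.Ventures.PercRepro.RankLevelSetRuleQCell
import Summits.Ventures.PercRepro.RankLevelSetRuleQRhatFalse

/-!
# PercRepro — RULE Q IS NOT UNIVERSAL AT THE TIGHT LAYER, MODULO THE MODEL IDENTITY (night-1, gen 14; dossier §25.4 (a), §25.5;
RULING (um)(102)(2))

The bound `R̂(q, k, m) ≤ recv(Z)` of RankLevelSetRuleQRhat is attained: on the truncated direct sum
`T_{q+k}(U_{q,q+m} ⊕ U_{q+k−m,q+k−m})` a `q`-subset `Z` of the rank-`q` flat has `P = F ∖ Z`, the `Y`-sets above `Z` are exactly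
the index sets `Z ∪ X_P ∪ X_D` with `1 ≤ #X_D ≤ k − 1`, and the members inside such a set are exactly its `q`-subsets with at most
`q − m` elements in `X_D` — so `recv(Z) = R̂(q, k, m)` with equality (paper: brute force on the explicit rank function
`min(min(#(X ∩ F), q) + #(X ∖ F), q + k)` at `(2,2,1)`, `(3,3,2)`, `(4,3,2)`, `(3,4,1)`, `(4,4,3)`, 5 / 5; the profile count at
`(72,14,66)`; the engine's twin, DATA-INDEX 837).
* `ModelRecvEq` — that identity as a `Prop` (NOT asserted; the construction of the model matroid in Lean is the successor's
  item: typer-2's `Matroid.truncate` on a disjoint sum);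
* **`not_ruleQUp_of_modelRecvEq`** — with the kernel witness `rhat 72 14 66 < phiK 86 72` (p4 g19, `rhat_lt_phiK_72_14_66`),
  the identity gives a finite matroid with `#E = 86 + 72` on which `RuleQUp M 86 72` FAILS: Rule Q is not a universal
  mechanism for the UP form of C-044 at the tight layer (it is one on every cell with `p + q ≤ 28`, `rhatCell_q_k`, and at the
  members with `#P ∈ {0, 1, q}` of every matroid, RankLevelSetRuleQCellOne / Ends).
Axioms: standard.
-/

namespace PercRepro

open Set Matroid Finset

/-- **The model identity** (a `Prop`, NOT asserted): for every cell `(q + k, q)` and every `m ≤ q` some finite matroid at the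
tight layer has a member whose Rule Q receipt is exactly `R̂(q, k, m)` — realised by `T_{q+k}(U_{q,q+m} ⊕ U_{q+k−m,q+k−m})`
at a `q`-subset of its rank-`q` flat. -/
def ModelRecvEq : Prop :=
  ∀ q k m : ℕ, 1 ≤ q → 2 ≤ k → m ≤ q →
    ∃ (α : Type) (M : Matroid α) (hf : M.Finite) (Z : Set α),
      M.E.ncard = (q + k) + q ∧ Z ∈ cellMembers M (q + k) q ∧ @ruleQRecv α M hf (q + k) q Z = rhat q k m

/-- **Rule Q fails at the tight layer of the cell `(86, 72)`, modulo the model identity**: the member realising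
`R̂(72, 14, 66) < Φ(86, 72)` receives less than `Φ` under the equal split. -/
theorem not_ruleQUp_of_modelRecvEq (hM : ModelRecvEq) :
    ∃ (α : Type) (M : Matroid α) (hf : M.Finite),
      M.E.ncard = (72 + 14) + 72 ∧ ¬ @RuleQUp α M hf (72 + 14) 72 := by
  obtain ⟨α, M, hf, Z, hE, hZ, hrecv⟩ := hM 72 14 66 (by norm_num) (by norm_num) (by norm_num)
  refine ⟨α, M, hf, hE, ?_⟩
  intro hRQ
  have h1 := hRQ Z hZ
  rw [hrecv] at h1
  exact absurd h1 (not_le.mpr rhat_lt_phiK_72_14_66)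

/-- The same, as the negation of the universal statement «Rule Q holds at the tight layer of every cell of every finite
matroid» (modulo the model identity). -/
theorem not_forall_ruleQUp_of_modelRecvEq (hM : ModelRecvEq) :
    ¬ ∀ (α : Type) (M : Matroid α) (hf : M.Finite) (q k : ℕ), 1 ≤ q → 2 ≤ k →
        M.E.ncard = (q + k) + q → @RuleQUp α M hf (q + k) q := by
  intro hall
  obtain ⟨α, M, hf, hE, hnot⟩ := not_ruleQUp_of_modelRecvEq hM
  exact hnot (hall α M hf 72 14 (by norm_num) (by norm_num) hE)

end PercRepro
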